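import Literature.NumberTheory.EllipticCurves.KubertTate289CubicShaTwo
import Literature.NumberTheory.EllipticCurves.KubertTate289ShaFive
import Literature.NumberTheory.EllipticCurves.ShaCorankBaseChange
import Literature.NumberTheory.EllipticCurves.SelmerCorankHolds
import Literature.NumberTheory.EllipticCurves.KubertTateFiveVeluIsogeny
import Literature.NumberTheory.EllipticCurves.IsogenyMordellWeilRankProofs
import HarnessLib

/-!
# `t₂ = 0` at rank `2` for a curve WITHOUT rational `2`-torsion: the Kubert–Tate curve `E_{28/9} = [-19, -252, -2268, 0, 0]`

PROOF-ONLY file (theorems only, no definition, no named fact, no `sorry`), topic `NumberTheory/EllipticCurves`; sequel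
of `KubertTate289ShaFive` (`rank E_{28/9}(ℚ) = 2`, `t₅(E_{28/9}) = 0` by the `μ₅`-descent) and of the cubic chain
`KubertTate289Cubic*` (complete `2`-isogeny descent of `E_{28/9} ⊗ K` over the cubic `2`-division field
`K = ℚ(γ)`, `γ³ - γ² + 27γ + 36 = 0`, ending in `KubertTate289Cubic.shaCorank_two_baseChange_adjoinRoot_eq_zero :
t₂(E_{28/9} ⊗ K) = 0`). `E_{28/9}(ℚ)[2] = 0` (the `2`-division cubic is irreducible), so no `2`-isogeny descent over
`ℚ` exists; the door at `2` is opened UPSTAIRS and brought down by `t_p(E/ℚ) ≤ t_p(E ⊗ K/K)` (the restriction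
`Ш(E/ℚ) → Ш(E_K/K)` has finite kernel; tree `WeierstrassCurve.shaCorank_eq_zero_of_shaCorank_baseChange_eq_zero`,
Darmon 2004 Exercise 3.18). With NO `L`-function, `p`-adic or conjectural input:

* `shaCorank_two_eq_zero` — **`t₂(E_{28/9}) = corank_{ℤ₂} Ш(E_{28/9}/ℚ)[2^∞] = 0`**;
* `finite_primaryComponent_sha_two` — `Ш(E_{28/9}/ℚ)[2^∞]` is finite;
* `shaCorank_two_and_five_eq_zero` — both doors `t₂ = t₅ = 0` on one rank-`2` curve, by descent alone;
* `selmerCorank_two`, `selmerCorank_five` — `corank Sel_{2^∞}(E/ℚ) = corank Sel_{5^∞}(E/ℚ) = 2 = rank E(ℚ)`;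
* `rankTwo_doors_two_five` — the row in one line;
* §2 the `μ₅`-side curve `E'_{28/9} = E_{28/9}/⟨T⟩ = kubertTateFive' 28 9` (Vélu; NO rational `5`-torsion and no
  rational `2`-torsion): `mordellWeilRank_dual_eq`, `shaCorank_two_dual_eq_zero`, `shaCorank_five_dual_eq_zero` —
  rank `2`, `t₂ = t₅ = 0` — by isogeny invariance (`IsIsogenous.mordellWeilRank_eq`, `IsIsogenous.shaCorank_eq`).

BSD is not touched by any of this.

## References
* [SilvermanAEC2009] J. H. Silverman, *The Arithmetic of Elliptic Curves*, 2nd ed. (2009), Thm. X.4.2, Prop. X.4.9.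
* [Darmon2004] H. Darmon, *Rational Points on Modular Elliptic Curves*, CBMS 101 (2004), §3.9, Exercise 3.18.
* [Greenberg1999LNM] R. Greenberg, *Iwasawa theory for elliptic curves*, LNM 1716 (1999), §1 (pp. 54–57).
-/

noncomputable section

open WeierstrassCurve
open Literature.NumberTheory.EllipticCurves Literature.NumberTheory.NumberFields
open Literature.NumberTheory.NumberFields.MonicCubic

namespace Literature.NumberTheory.EllipticCurves

namespace KubertTate289Descent

/-- **`t₂(E_{28/9}) = corank_{ℤ₂} Ш(E_{28/9}/ℚ)[2^∞] = 0`, UNCONDITIONALLY**: `t₂(E ⊗ K) = 0` over the cubic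
`2`-division field `K = ℚ[T]/(T³ - T² + 27T + 36)` by the complete `2`-isogeny descent
(`KubertTate289Cubic.shaCorank_two_baseChange_adjoinRoot_eq_zero`), and `t₂(E/ℚ) ≤ t₂(E ⊗ K/K)`.
[cite: SilvermanAEC2009, Thm. X.4.2(a)] [cite: Darmon2004, §3.9 and Exercise 3.18] -/
theorem shaCorank_two_eq_zero : (kubertTateFive (((28 : ℤ) : ℚ)) (((9 : ℤ) : ℚ))).shaCorank 2 = 0 := by
  haveI := isElliptic
  haveI : Fact (Irreducible (polyQ (-1) 27 36)) := ⟨CubicField14483.irreducible_polyQ⟩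
  exact WeierstrassCurve.shaCorank_eq_zero_of_shaCorank_baseChange_eq_zero _ (AdjoinRoot (polyQ (-1) 27 36)) 2
    KubertTate289Cubic.shaCorank_two_baseChange_adjoinRoot_eq_zero

/-- **`Ш(E_{28/9}/ℚ)[2^∞]` is finite**, unconditionally. [cite: SilvermanAEC2009, Thm. X.4.2(a)]
[cite: Greenberg1999LNM, §1 (pp. 54–57)] -/
theorem finite_primaryComponent_sha_two :
    Finite (AddCommGroup.primaryComponent (kubertTateFive (((28 : ℤ) : ℚ)) (((9 : ℤ) : ℚ))).sha 2) := by
  haveI := isElliptic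
  exact (finite_primaryComponent_sha_iff_shaCorank_eq_zero _ 2).mpr shaCorank_two_eq_zero

/-- **Both doors on one rank-`2` curve, by descent alone: `t₂(E_{28/9}) = 0 ∧ t₅(E_{28/9}) = 0`.**
[cite: SilvermanAEC2009, Thm. X.4.2(a)] -/
theorem shaCorank_two_and_five_eq_zero :
    (kubertTateFive (((28 : ℤ) : ℚ)) (((9 : ℤ) : ℚ))).shaCorank 2 = 0 ∧
      (kubertTateFive (((28 : ℤ) : ℚ)) (((9 : ℤ) : ℚ))).shaCorank 5 = 0 :=
  ⟨shaCorank_two_eq_zero, shaCorank_five_eq_zero⟩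

/-- **`corank_{ℤ₂} Sel_{2^∞}(E_{28/9}/ℚ) = 2 = rank E_{28/9}(ℚ)`** (Greenberg's identity `corank Sel = rank + t_p`,
tree `selmerCorank_eq_mordellWeilRank_add_holds`; rank `2` by the `μ₅`-descent). [cite: Greenberg1999LNM, §1 (pp. 54–57)] -/
theorem selmerCorank_two : (kubertTateFive (((28 : ℤ) : ℚ)) (((9 : ℤ) : ℚ))).selmerCorank 2 = 2 := by
  haveI := isElliptic
  rw [WeierstrassCurve.selmerCorank_eq_mordellWeilRank_add_holds, mordellWeilRank_eq, shaCorank_two_eq_zero]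

/-- **`corank_{ℤ₅} Sel_{5^∞}(E_{28/9}/ℚ) = 2 = rank E_{28/9}(ℚ)`.** [cite: Greenberg1999LNM, §1 (pp. 54–57)] -/
theorem selmerCorank_five : (kubertTateFive (((28 : ℤ) : ℚ)) (((9 : ℤ) : ℚ))).selmerCorank 5 = 2 := by
  haveI := isElliptic
  haveI : Fact (Nat.Prime 5) := ⟨Nat.prime_five⟩
  rw [WeierstrassCurve.selmerCorank_eq_mordellWeilRank_add_holds, mordellWeilRank_eq, shaCorank_five_eq_zero]

/-- **The rank-`2` row in one line**: `rank = 2`, `t₂ = t₅ = 0`, `corank Sel_{2^∞} = corank Sel_{5^∞} = 2`.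
[cite: SilvermanAEC2009, Thm. X.4.2(a)] [cite: Greenberg1999LNM, §1 (pp. 54–57)] -/
theorem rankTwo_doors_two_five :
    (kubertTateFive (((28 : ℤ) : ℚ)) (((9 : ℤ) : ℚ))).mordellWeilRank = 2 ∧
      (kubertTateFive (((28 : ℤ) : ℚ)) (((9 : ℤ) : ℚ))).shaCorank 2 = 0 ∧
      (kubertTateFive (((28 : ℤ) : ℚ)) (((9 : ℤ) : ℚ))).shaCorank 5 = 0 ∧
      (kubertTateFive (((28 : ℤ) : ℚ)) (((9 : ℤ) : ℚ))).selmerCorank 2 = 2 ∧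
      (kubertTateFive (((28 : ℤ) : ℚ)) (((9 : ℤ) : ℚ))).selmerCorank 5 = 2 :=
  ⟨mordellWeilRank_eq, shaCorank_two_eq_zero, shaCorank_five_eq_zero, selmerCorank_two, selmerCorank_five⟩

/-! ## §2 The `μ₅`-side curve `E'_{28/9} = E_{28/9}/⟨T⟩` (Vélu): rank `2`, `t₂ = t₅ = 0` by isogeny invariance -/

/-- `E_{28/9} ∼ E'_{28/9}` over `ℚ` (Vélu's `5`-isogeny, tree `KubertTateVelu.fiveIsogeny`). [cite: SilvermanAEC2009, Thm. III.4.8] -/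
theorem isIsogenous_dual :
    haveI := isElliptic
    IsIsogenous (kubertTateFive (((28 : ℤ) : ℚ)) (((9 : ℤ) : ℚ))) (KubertTateVelu.kubertTateFive' (((28 : ℤ) : ℚ)) (((9 : ℤ) : ℚ))) := by
  haveI := isElliptic
  exact ⟨KubertTateVelu.fiveIsogeny _ _⟩

/-- **`rank E'_{28/9}(ℚ) = 2`** (isogeny invariance of the rank). [cite: SilvermanAEC2009, Thm. III.4.8] -/
theorem mordellWeilRank_dual_eq :
    (KubertTateVelu.kubertTateFive' (((28 : ℤ) : ℚ)) (((9 : ℤ) : ℚ))).mordellWeilRank = 2 := by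
  haveI := isElliptic
  rw [← isIsogenous_dual.mordellWeilRank_eq, mordellWeilRank_eq]

/-- **`t₂(E'_{28/9}) = 0`** — a rank-`2` curve with neither rational `2`- nor rational `5`-torsion (the corank of
`Ш[2^∞]` is an isogeny invariant). [cite: Greenberg1999LNM, §1 (pp. 54–57)] -/
theorem shaCorank_two_dual_eq_zero :
    (KubertTateVelu.kubertTateFive' (((28 : ℤ) : ℚ)) (((9 : ℤ) : ℚ))).shaCorank 2 = 0 := by
  haveI := isElliptic
  rw [← isIsogenous_dual.shaCorank_eq 2, shaCorank_two_eq_zero]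

/-- **`t₅(E'_{28/9}) = 0`.** [cite: Greenberg1999LNM, §1 (pp. 54–57)] -/
theorem shaCorank_five_dual_eq_zero :
    (KubertTateVelu.kubertTateFive' (((28 : ℤ) : ℚ)) (((9 : ℤ) : ℚ))).shaCorank 5 = 0 := by
  haveI := isElliptic
  haveI : Fact (Nat.Prime 5) := ⟨Nat.prime_five⟩
  rw [← isIsogenous_dual.shaCorank_eq 5, shaCorank_five_eq_zero]

end KubertTate289Descent

end Literature.NumberTheory.EllipticCurves

end
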